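import Summits.QuantumAdvantage.QuantumAdvantage.Theorems.MobiusLadderLiouvilleOrthogonalTC0OrLtf
import Summits.QuantumAdvantage.QuantumAdvantage.Theorems.MobiusLadderLiouvilleOrthogonalTC0DepthTwoOrNf
import HarnessLib

/-!
# Crux `MobiusLadder.LiouvilleOrthogonalTC0` (stmt-QuantumAdvantage-1393): the depth-two `∧/∨`-top rung
in circuit language

Line `Sketch`, skeleton v6 (lead `prover-line-stmt-QuantumAdvantage-1393-c4-0`). The Kane rung
`liouville_orthogonal_orLtf` (`…OrLtf.lean`) read through the syntactic depth-two normal form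
`depthTwo_or_nf` (`…DepthTwoOrNf.lean`):

* `liouville_orthogonal_depthTwo_andOr` — for every size polynomial `p` and `ε > 0`, for all
  sufficiently large `n`, every circuit `C` on the `n` binary digits over `tcBasis` (`¬` free, `∧ₖ`,
  `∨ₖ`, `MAJₖ` of any fan-in) with `acDepth ≤ 2`, `size ≤ p(n)`, and all of whose MAJORITY gates sit at
  `acWeight`-depth `≤ 1` — i.e. polynomial-size depth-two threshold circuits whose output gate (under
  free negations) is an `AND` or an `OR` of threshold gates and literals: intersections and unions of
  polynomially many halfspaces in the digits — satisfies `|Σ_{N<2ⁿ} λ(N) sgn C(bits N)| ≤ ε 2ⁿ`.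

Unconditional (Bourgain's Möbius–Walsh bound + Green §2 + Peres-type symmetrisation + KANE 2014).
Together with `LiouvilleOrthogonalTC0_depth_le_one` (`…DepthOne.lean`) and
`liouville_orthogonal_ltf_combination_poly` (`…LtfCombinationPoly.lean`, majority of `≤ n^α` threshold
gates) this is everything the line proves at depth two; the open residue there is a majority gate over
more than `n^α` distinct threshold gates.
-/

set_option linter.dupNamespace false -- D-0017: single-problem summit ⇒ `QuantumAdvantage.QuantumAdvantage` by design

noncomputable section

namespace Summit.QuantumAdvantage.QuantumAdvantage.Theorems.LiouvilleOrthogonalTC0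

open Filter Finset
open Literature.Computability.Complexity
open Literature.Computability.Complexity.GateList
open Literature.Probability.RandomGraphs.LowDegree (sgn)

namespace DepthTwoAndOr

/-- Polynomial size plus `n` is eventually below a power of `n`: `p(n) + n ≤ n^{deg p + 2}`. -/
theorem eventually_eval_add_le_pow (p : Polynomial ℕ) :
    ∀ᶠ n : ℕ in atTop, p.eval n + n ≤ n ^ (p.natDegree + 2) := by
  filter_upwards [eventually_ge_atTop (p.eval 1 + 2)] with n hn
  have hn1 : 1 ≤ n := by omega
  have h1 : p.eval n ≤ p.eval 1 * n ^ p.natDegree := by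
    rw [Polynomial.eval_eq_sum_range, Polynomial.eval_eq_sum_range, Finset.sum_mul]
    refine Finset.sum_le_sum fun i hi => ?_
    rw [one_pow, mul_one]
    have hi' : i ≤ p.natDegree := by
      have := Finset.mem_range.1 hi; omega
    exact Nat.mul_le_mul_left _ (Nat.pow_le_pow_right hn1 hi')
  calc p.eval n + n ≤ p.eval 1 * n ^ p.natDegree + n * n ^ p.natDegree := by
        have : n ≤ n * n ^ p.natDegree := Nat.le_mul_of_pos_right _ (Nat.pow_pos hn1)
        omega
    _ = (p.eval 1 + n) * n ^ p.natDegree := by ring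
    _ ≤ (n * n) * n ^ p.natDegree := by
        refine Nat.mul_le_mul_right _ ?_
        nlinarith
    _ = n ^ (p.natDegree + 2) := by ring

end DepthTwoAndOr

open DepthTwoAndOr in
/-- **`λ` is orthogonal to every polynomial-size depth-two threshold circuit with an `∧/∨` top gate**
(unconditional; Kane's theorem). For every size polynomial `p` and `ε > 0`, for all sufficiently large
`n`, every circuit `C` over `tcBasis` on the `n` binary digits with `acDepth ≤ 2`, `size ≤ p(n)` and
every majority gate at `acWeight`-depth `≤ 1` satisfies `|Σ_{N<2ⁿ} λ(N) · sgn C(bits N)| ≤ ε · 2ⁿ`. -/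
theorem liouville_orthogonal_depthTwo_andOr (p : Polynomial ℕ) : ∀ ε : ℝ, 0 < ε →
    ∀ᶠ n : ℕ in atTop, ∀ C : Circuit (Fin n), C.IsOver tcBasis → C.acDepth ≤ 2 →
      (∀ (j : ℕ) (hj : j < C.gates.length), (∃ k, (C.gates[j]).fn = GateFn.maj k) →
        (wdepths acWeight C.gates).getD j 0 ≤ 1) →
      C.size ≤ p.eval n →
        |∑ N ∈ Finset.range (2 ^ n), ((ArithmeticFunction.liouville N : ℤ) : ℝ) *
            sgn (C.eval (fun i : Fin n => Nat.testBit N i))| ≤ ε * (2 : ℝ) ^ n := by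
  intro ε hε
  filter_upwards [liouville_orthogonal_orLtf (p.natDegree + 2) ε hε, eventually_eval_add_le_pow p]
    with n hn hpn C hB hd hM hs
  obtain ⟨K, b, w, t, hK, hor⟩ := depthTwo_or_nf C hB hd hM
  have hKn : K ≤ n ^ (p.natDegree + 2) := hK.trans ((Nat.add_le_add_right hs n).trans hpn)
  have h := hn K hKn b w t
  simp only [← hor] at h
  exact h

/-- **Registered stub `stub_depthTwoAndOr`** (line `Sketch`, v6, lead c4): verbatim
`liouville_orthogonal_depthTwo_andOr`. -/
theorem stub_depthTwoAndOr (p : Polynomial ℕ) : ∀ ε : ℝ, 0 < ε → ∀ᶠ n : ℕ in atTop, ∀ C : Circuit (Fin n), C.IsOver tcBasis → C.acDepth ≤ 2 → (∀ (j : ℕ) (hj : j < C.gates.length), (∃ k, (C.gates[j]).fn = GateFn.maj k) → (wdepths acWeight C.gates).getD j 0 ≤ 1) → C.size ≤ p.eval n → |∑ N ∈ Finset.range (2 ^ n), ((ArithmeticFunction.liouville N : ℤ) : ℝ) * sgn (C.eval (fun i : Fin n => Nat.testBit N i))| ≤ ε * (2 : ℝ) ^ n :=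
  liouville_orthogonal_depthTwo_andOr p

end Summit.QuantumAdvantage.QuantumAdvantage.Theorems.LiouvilleOrthogonalTC0

end
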